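import Literature.AlgebraicGeometry.HodgeTheory.BettiHodgeConjectureProductOfThreefoldsHomDegreeThree
import Literature.AlgebraicGeometry.HodgeTheory.BettiKunnethPiecesPrimitiveReduction
import Literature.AlgebraicGeometry.HodgeTheory.BettiKunnethPiecesPrimitiveEvenCount
import HarnessLib

/-!
# `HC(Y × Z)` from ONE vanishing `Hom_HS(H^{mₒ}(Y), H^{nₒ}(Z)((nₒ − mₒ)/2)) = 0` in the top odd degrees `mₒ ≤ dim Y`, `nₒ ≤ dim Z`, plus `HC(Y)`, `HC(Z)` and the even biprimitive
# pieces (or primitive counts `dim Hom_HS(P^{2a}Y, P^{2b}Z(b − a)) ≤ ρ₀ᵃ(Y) ρ₀ᵇ(Z)`); two fourfolds, threefold × fourfold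
# (Voisin I Cor. 6.26, Rem. 6.27, Lemma 7.23, Lemma 7.26, §11.3.3 Thm. 11.38–11.40, Lemma 11.41, p. 287; Voisin II Prop. 9.20; Deligne Hodge II 2.1.13)

Family `hodge`, lane `lit-hodgefound` (Track 2 foundations library; Layers A1/A4), layer `Literature/AlgebraicGeometry/HodgeTheory`.  THEOREMS ONLY (no definition, no named fact,
no instance, no notation; D-0026 net debt `0`).  Prover seat `lit-hodgefound-p21` (generation 39, row g39-#4), sequel of the seat's g39-#1/#2 `BettiLefschetzDecompositionHodgeStructures`
(`Hom_HS(Hⁱ(Y), Hʲ(Z)(s))` block by block through the primitive parts), g39-#3 `BettiHodgeConjectureProductOfThreefoldsHomDegreeThree` (two threefolds), g38-#5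
`BettiKunnethPiecesPrimitiveReduction` (`HC(Y × Z)` reduces to the biprimitive Hodge classes of the pieces `Hⁱ(Y) ⊗ Hʲ(Z)`, `1 ≤ i ≤ dim Y`, `1 ≤ j ≤ dim Z`), g38-#7
`BettiPrimitiveSubHodgeStructure` (`Hom_HS(Pⁱ(Y), Pʲ(Z)(c − i)) = 0` kills the biprimitive Hodge classes of `Hⁱ(Y) ⊗ Hʲ(Z)`) and g38-#8 `BettiKunnethPiecesPrimitiveEvenCount` (an even
biprimitive piece by counting).

THE MATHEMATICS.  Let `Y`, `Z` be smooth projective of dimensions `m`, `n` with rational Kähler classes.  By the Lefschetz decomposition `Hⁱ⁰(Y) = ⊕_{i + 2t = i₀} Lᵗ Pⁱ(Y)`,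
`Lᵗ Pⁱ(Y) ≅ Pⁱ(Y)(−t)` (Cor. 6.26, Rem. 6.27, Lemma 7.23; for `i₀ ≤ m` every `i ≡ i₀ (mod 2)`, `i ≤ i₀` occurs), a morphism of Hodge structures `Hⁱ⁰(Y) → Hʲ⁰(Z)(s)` is a matrix of
blocks `Pⁱ(Y) → Pʲ(Z)(s + tᵢ − tⱼ)`, so **`Hom_HS(Hⁱ⁰(Y), Hʲ⁰(Z)(s)) = 0` forces `Hom_HS(Pⁱ(Y), Pʲ(Z)((j − i)/2)) = 0` for all `i ≤ i₀`, `j ≤ j₀` of the same parities** (§1), and then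
(Lemma 11.41 on the polarised primitive parts, Lemma 7.26) every Hodge class of `Pⁱ(Y) ⊗ Pʲ(Z)`, i.e. every biprimitive Hodge class of the Künneth piece `Hⁱ(Y) ⊗ Hʲ(Z) ⊂ H^{i+j}(Y × Z)`,
vanishes (§2).  Since `HC(Y × Z)` reduces (hard Lefschetz on both factors, Thm. 11.38/11.40, Prop. 9.20) to `HC(Y)`, `HC(Z)` and the algebraicity of the cross products of the biprimitive
Hodge classes of the pieces `Hⁱ(Y) ⊗ Hʲ(Z)`, `1 ≤ i ≤ m`, `1 ≤ j ≤ n`, `i + j` even, and the pieces with `i`, `j` odd are governed by the top odd degrees `mₒ ∈ {m − 1, m}`, `nₒ ∈ {n − 1, n}`,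
we get the criterion (§3): **`HC(Y × Z)` holds if `HC(Y)`, `HC(Z)`, `Hom_HS(H^{mₒ}(Y), H^{nₒ}(Z)((nₒ − mₒ)/2)) = 0`, and the biprimitive Hodge classes of the even pieces `H^{2a}(Y) ⊗ H^{2b}(Z)`
(`1 ≤ a ≤ m/2`, `1 ≤ b ≤ n/2`) have algebraic cross products** — the last condition holding as soon as `dim_ℚ Hom_HS(P^{2a}(Y), P^{2b}(Z)(b − a)) ≤ dim Hdgᵃ(P^{2a}Y) · dim Hdgᵇ(P^{2b}Z)`
(no exceptional classes on the primitive piece; the primitive Hodge classes are algebraic under `HC(Y)`, `HC(Z)`).  §4: for two FOURFOLDS `F`, `F'` this reads **`HC(F × F')` ⟸ `HC(F)`, `HC(F')`,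
`Hom_HS(H³(F), H³(F')) = 0` and the four primitive counts in degrees `(2,2)`, `(2,4)`, `(4,2)`, `(4,4)`**; for a threefold `T` and a fourfold `F`, **`HC(T × F)` ⟸ `HC(F)`, `Hom_HS(H³(T), H³(F)) = 0`
and two counts**; for a surface `S` and a fourfold `F`, **`HC(S × F)` ⟸ `HC(F)`, `Hom_HS(H¹(S), H³(F)(1)) = 0` and two counts**.

WHAT IS PROVED (all binders explicit; `P = BettiUniverse.primitiveHodge`, `H = BettiUniverse.hodge`).
* §1 `BettiUniverse.subsingleton_hom_primitiveHodge_of_subsingleton_hom_hodge`: `Hom_HS(Hⁱ⁰(Y), Hʲ⁰(Z)(s)) = 0`, `i + 2tᵢ = i₀`, `j + 2tⱼ = j₀`, `i + tᵢ ≤ m`, `j + tⱼ ≤ n`, `i + j = 2c` ⟹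
  `Hom_HS(Pⁱ(Y), Pʲ(Z)(c − i)) = 0`.
* §2 `BettiUniverse.eq_zero_of_biprimitive_of_subsingleton_hom_hodge`: under the same vanishing (`i₀ ≤ m`, `j₀ ≤ n`), every Hodge class `t` of the piece `Hⁱ(Y) ⊗ Hʲ(Z) ⊂ H^{2c}` with
  `(Lʳ ⊗ id) t = 0 = (id ⊗ L^{r'}) t` (`i + r = m + 1`, `j + r' = n + 1`) is `0`.
* §1 `BettiUniverse.subsingleton_hom_hodge_tateTwist_iff_forall_primitiveHodge`: `Hom_HS(Hⁱ⁰(Y), Hʲ⁰(Z)(s)) = 0` ⟺ all these blocks vanish.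
* §3 `BettiUniverse.ofRatClass_mem_algebraicClasses_of_mem_hodgeClasses_primitiveHodge_of_hodgeConjectureFor` (primitive Hodge classes are algebraic under `HC`);
  `BettiUniverse.hodgeConjectureFor_tensor_of_subsingleton_hom_primitiveHodge_odd` (`HC(Y × Z)` ⟸ `HC(Y)`, `HC(Z)`, all odd primitive blocks `Hom_HS(Pⁱ(Y), Pʲ(Z)((j − i)/2)) = 0`, even
  biprimitive pieces algebraic), `…_of_finrank_hom_le` (even pieces by the primitive counts); `BettiUniverse.subsingleton_hom_primitiveHodge_odd_of_subsingleton_hom_hodge_top` (the top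
  odd `Hom_HS` governs every odd primitive block); `BettiUniverse.hodgeConjectureFor_tensor_of_subsingleton_hom_hodge_odd` (the criterion from the ONE vanishing
  `Hom_HS(H^{mₒ}(Y), H^{nₒ}(Z)(s)) = 0`) and `BettiUniverse.hodgeConjectureFor_tensor_of_subsingleton_hom_hodge_odd_of_finrank_hom_primitiveHodge_le` (with the primitive counts).
* §4 `BettiUniverse.hodgeConjectureFor_tensor_fourfolds_of_subsingleton_hom_three_of_finrank_hom_primitiveHodge_le` (`F × F'`),
  `BettiUniverse.hodgeConjectureFor_threefold_tensor_fourfold_of_subsingleton_hom_three_of_finrank_hom_primitiveHodge_le` (`T × F`),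
  `BettiUniverse.hodgeConjectureFor_surface_tensor_fourfold_of_subsingleton_hom_one_three_of_finrank_hom_primitiveHodge_le` (`S × F`).

THE PRINTS.  C. Voisin (2002) [VoisinHodgeI2002] §6.2.3 Thm. 6.25, Cor. 6.26, Rem. 6.27 (held text p0125–p0126); §7.1.2 Lemma 7.26 (p0148); §7.3.1 Lemma 7.23, Cor. 7.24 (p0147); §11.3.3
Thm. 11.38, Def. 11.39, Thm. 11.40, Lemma 11.41 (p0236), p. 287; §11.3.1 Thm. 11.30.  C. Voisin (2003) [VoisinHodgeII2003] §9.2.4 Prop. 9.20.  P. Deligne (1971) [DeligneHodgeII1971] 2.1,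
2.1.13–2.1.15.  P. Deligne (2000) [Deligne2000] §1.  The consolidation into ONE `Hom`-vanishing is bookkeeping on these prints (no new mathematics is claimed).

## References
* [VoisinHodgeI2002] C. Voisin, *Hodge Theory and Complex Algebraic Geometry I* (2002) — §6.2.3 Thm. 6.25, Cor. 6.26, Rem. 6.27; §7.1.2 Lemma 7.26; §7.3.1 Lemma 7.23; §11.3.3
  Thm. 11.38–11.40, Lemma 11.41, p. 287; §11.3.1 Thm. 11.30.
* [VoisinHodgeII2003] C. Voisin, *Hodge Theory and Complex Algebraic Geometry II* (2003) — §9.2.4 Prop. 9.20.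
* [DeligneHodgeII1971] P. Deligne, *Théorie de Hodge II*, Publ. Math. IHÉS 40 (1971) — 2.1, 2.1.13–2.1.15.
* [Deligne2000] P. Deligne, *The Hodge conjecture* (Clay, 2000) — §1.

## Provenance
Lane `lit-hodgefound` (Hodge path, Track 2), prover seat `lit-hodgefound-p21` (generation 39), self-proposed row g39-#4 (sequel of g39-#1/#2/#3 and g38-#5/#7/#8).
-/

noncomputable section

open scoped TensorProduct
open CategoryTheory MonoidalCategory Module Finset
open Literature.AlgebraicTopology.SingularHomology
open Literature.Geometry.Kaehler

namespace Literature.AlgebraicGeometry.HodgeTheory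

open Literature.AlgebraicGeometry.Motives
open Literature.AlgebraicGeometry.Motives.HodgeStructure

variable {m n d : ℕ} {Y Z T F F' : SchemeOver ℂ}

section Blocks

/-- **A block of a vanishing `Hom_HS`.**  If `Hom_HS(Hⁱ⁰(Y), Hʲ⁰(Z)(s)) = 0` then `Hom_HS(Pⁱ(Y), Pʲ(Z)(c − i)) = 0` for every `i + 2tᵢ = i₀`, `j + 2tⱼ = j₀` with `i + tᵢ ≤ dim Y`,
`j + tⱼ ≤ dim Z` (`i + j = 2c`): along the Lefschetz decompositions `Hⁱ⁰ = ⊕ Lᵗ Pⁱ`, `Lᵗ Pⁱ ≅ Pⁱ(−t)`, it is the block `((i, tᵢ), (j, tⱼ))`. [cite: VoisinHodgeI2002, §6.2.3 Thm. 6.25, Cor. 6.26,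
Rem. 6.27 and §7.3.1 Lemma 7.23, Lemma 7.26] [cite: DeligneHodgeII1971, 2.1, 2.1.13–2.1.14] -/
theorem BettiUniverse.subsingleton_hom_primitiveHodge_of_subsingleton_hom_hodge (hHD : exists_isReal_hodgeModel) (hY : IsSmoothProjective m Y) (hZ : IsSmoothProjective n Z)
    (DY : KaehlerRationalDatum m Y) (DZ : KaehlerRationalDatum n Z) {i₀ j₀ : ℕ} {s : ℤ} (hs : (j₀ : ℤ) - 2 * s = i₀)
    (h : Subsingleton (Hom (BettiUniverse.hodge hHD hY i₀) (((BettiUniverse.hodge hHD hZ j₀).tateTwist s).cast hs))) {i j ti tj c : ℕ} (hi : i + 2 * ti = i₀)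
    (hj : j + 2 * tj = j₀) (him : i + ti ≤ m) (hjn : j + tj ≤ n) (hc : i + j = 2 * c) :
    Subsingleton (Hom (BettiUniverse.primitiveHodge hHD hY DY i) (((BettiUniverse.primitiveHodge hHD hZ DZ j).tateTwist ((c : ℤ) - i)).cast (by omega))) := by
  have hb := (BettiUniverse.subsingleton_hom_hodge_tateTwist_iff_primitiveHodge hHD hY hZ DY DZ i₀ j₀ hs).1 h ⟨(i, ti), hi⟩ ⟨(j, tj), hj⟩ him hjn
  exact (subsingleton_hom_twistCast_right_congr _ _ (by push_cast; omega) _ _).1 hb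

/-- The untwisted case `j₀ = i₀`: **`Hom_HS(Hⁱ⁰(Y), Hⁱ⁰(Z)) = 0 ⟹ Hom_HS(Pⁱ(Y), Pʲ(Z)(c − i)) = 0`** for `i + 2tᵢ = i₀ = j + 2tⱼ`, `i + tᵢ ≤ dim Y`, `j + tⱼ ≤ dim Z`, `i + j = 2c`.
[cite: VoisinHodgeI2002, §6.2.3 Cor. 6.26, Rem. 6.27 and §7.3.1 Lemma 7.23, Lemma 7.26] [cite: DeligneHodgeII1971, 2.1] -/
theorem BettiUniverse.subsingleton_hom_primitiveHodge_of_subsingleton_hom_hodge_self (hHD : exists_isReal_hodgeModel) (hY : IsSmoothProjective m Y) (hZ : IsSmoothProjective n Z)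
    (DY : KaehlerRationalDatum m Y) (DZ : KaehlerRationalDatum n Z) {i₀ : ℕ} (h : Subsingleton (Hom (BettiUniverse.hodge hHD hY i₀) (BettiUniverse.hodge hHD hZ i₀))) {i j ti tj c : ℕ}
    (hi : i + 2 * ti = i₀) (hj : j + 2 * tj = i₀) (him : i + ti ≤ m) (hjn : j + tj ≤ n) (hc : i + j = 2 * c) :
    Subsingleton (Hom (BettiUniverse.primitiveHodge hHD hY DY i) (((BettiUniverse.primitiveHodge hHD hZ DZ j).tateTwist ((c : ℤ) - i)).cast (by omega))) :=
  BettiUniverse.subsingleton_hom_primitiveHodge_of_subsingleton_hom_hodge hHD hY hZ DY DZ (s := 0) (by omega) ((subsingleton_hom_twistCast_zero_right_iff _ _ (by omega)).2 h)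
    hi hj him hjn hc

/-- **`Hom_HS(Hⁱ⁰(Y), Hʲ⁰(Z)(s)) = 0` ⟺ all its primitive blocks vanish**: for every `i + 2tᵢ = i₀`, `j + 2tⱼ = j₀` with `i + tᵢ ≤ dim Y`, `j + tⱼ ≤ dim Z` (`i + j = 2c`),
`Hom_HS(Pⁱ(Y), Pʲ(Z)(c − i)) = 0` — the seat's g39-#1 block count with the blocks indexed by `(i, tᵢ, j, tⱼ, c)`. [cite: VoisinHodgeI2002, §6.2.3 Thm. 6.25, Cor. 6.26, Rem. 6.27 and
§7.3.1 Lemma 7.23, Lemma 7.26] [cite: DeligneHodgeII1971, 2.1, 2.1.13–2.1.14] -/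
theorem BettiUniverse.subsingleton_hom_hodge_tateTwist_iff_forall_primitiveHodge (hHD : exists_isReal_hodgeModel) (hY : IsSmoothProjective m Y) (hZ : IsSmoothProjective n Z)
    (DY : KaehlerRationalDatum m Y) (DZ : KaehlerRationalDatum n Z) (i₀ j₀ : ℕ) {s : ℤ} (hs : (j₀ : ℤ) - 2 * s = i₀) :
    Subsingleton (Hom (BettiUniverse.hodge hHD hY i₀) (((BettiUniverse.hodge hHD hZ j₀).tateTwist s).cast hs)) ↔
      ∀ (i j ti tj c : ℕ) (hi : i + 2 * ti = i₀) (hj : j + 2 * tj = j₀) (hc : i + j = 2 * c), i + ti ≤ m → j + tj ≤ n →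
        Subsingleton (Hom (BettiUniverse.primitiveHodge hHD hY DY i) (((BettiUniverse.primitiveHodge hHD hZ DZ j).tateTwist ((c : ℤ) - i)).cast (by omega))) := by
  refine ⟨fun h i j ti tj c hi hj hc him hjn ↦ BettiUniverse.subsingleton_hom_primitiveHodge_of_subsingleton_hom_hodge hHD hY hZ DY DZ hs h hi hj him hjn hc, fun h ↦ ?_⟩
  rw [BettiUniverse.subsingleton_hom_hodge_tateTwist_iff_primitiveHodge hHD hY hZ DY DZ i₀ j₀ hs]
  intro p q hp hq
  have hp2 := p.2
  have hq2 := q.2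
  obtain ⟨c, hc⟩ : ∃ c : ℕ, p.1.1 + q.1.1 = 2 * c := ⟨(p.1.1 + q.1.1) / 2, by omega⟩
  exact (subsingleton_hom_twistCast_right_congr _ _ (by omega) _ _).1 (h p.1.1 q.1.1 p.1.2 q.1.2 c hp2 hq2 hc hp hq)

end Blocks

section OddPieces

variable [HodgeTensorFacts.{0, 0}]

/-- **The biprimitive Hodge classes of the pieces below a vanishing `Hom_HS` vanish.**  If `Hom_HS(Hⁱ⁰(Y), Hʲ⁰(Z)(s)) = 0` with `i₀ ≤ dim Y`, `j₀ ≤ dim Z`, then for every `i ≡ i₀`, `j ≡ j₀ (mod 2)`,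
`i ≤ i₀`, `j ≤ j₀` (`i + j = 2c`), every Hodge class `t` of the Künneth piece `Hⁱ(Y) ⊗ Hʲ(Z) ⊂ H^{2c}(Y × Z)` with `(Lʳ ⊗ id) t = 0 = (id ⊗ L^{r'}) t` (`i + r = m + 1`, `j + r' = n + 1`: `t` is
biprimitive) is `0` — it is a Hodge class of `Pⁱ(Y) ⊗ Pʲ(Z)`, i.e. a morphism of Hodge structures `Pⁱ(Y)^∨ ≅ Pⁱ(Y)(i) → Pʲ(Z)` up to twist, and that block vanishes (§1). [cite: VoisinHodgeI2002, §6.2.3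
Def. 6.24, Cor. 6.26, Rem. 6.27, §7.1.2 Lemma 7.26 and §11.3.3 Lemma 11.41 (p. 286)] [cite: DeligneHodgeII1971, 2.1.13–2.1.14] -/
theorem BettiUniverse.eq_zero_of_biprimitive_of_subsingleton_hom_hodge (hHD : exists_isReal_hodgeModel) (hY : IsSmoothProjective m Y) (hZ : IsSmoothProjective n Z)
    (DY : KaehlerRationalDatum m Y) (DZ : KaehlerRationalDatum n Z) {i₀ j₀ : ℕ} {s : ℤ} (hs : (j₀ : ℤ) - 2 * s = i₀) (hi₀ : i₀ ≤ m) (hj₀ : j₀ ≤ n)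
    (h : Subsingleton (Hom (BettiUniverse.hodge hHD hY i₀) (((BettiUniverse.hodge hHD hZ j₀).tateTwist s).cast hs))) {i j ti tj c r r' : ℕ} (hi : i + 2 * ti = i₀)
    (hj : j + 2 * tj = j₀) (hc : i + j = 2 * c) (hr : i + r = m + 1) (hr' : j + r' = n + 1) {t : bettiCohomology Y i ⊗[ℚ] bettiCohomology Z j}
    (ht : t ∈ (BettiUniverse.kunnethSummand hHD hY hZ (2 * c) ⟨(i, j), HasAntidiagonal.mem_antidiagonal.2 hc⟩).hodgeClasses c)
    (h₁ : TensorProduct.map (lefschetzPowTo DY.η r i (i + 2 * r) rfl) LinearMap.id t = 0)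
    (h₂ : TensorProduct.map LinearMap.id (lefschetzPowTo DZ.η r' j (j + 2 * r') rfl) t = 0) : t = 0 :=
  BettiUniverse.eq_zero_of_biprimitive_of_subsingleton_hom hHD hY hZ DY DZ hc (by omega) (by omega) hr hr'
    (BettiUniverse.subsingleton_hom_primitiveHodge_of_subsingleton_hom_hodge hHD hY hZ DY DZ hs h hi hj (by omega) (by omega) hc) ht h₁ h₂

end OddPieces

section Criterion

variable [HodgeTensorFacts.{0, 0}]

omit [HodgeTensorFacts.{0, 0}] in
/-- **Under `HC(Y)` the primitive Hodge classes of `Y` are algebraic**: `y ∈ Hdgᵃ(P^{2a}(Y)) ⟹ y ⊗ 1 ∈ A^a(Y)`. [cite: VoisinHodgeI2002, §6.2.3 Rem. 6.27 and §11.3 Conj. 11.24, §11.3.1 Rem. 11.29]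
[cite: Deligne2000, §1] -/
theorem BettiUniverse.ofRatClass_mem_algebraicClasses_of_mem_hodgeClasses_primitiveHodge_of_hodgeConjectureFor (hHD : exists_isReal_hodgeModel) (hY : IsSmoothProjective m Y)
    (DY : KaehlerRationalDatum m Y) (hHC : HodgeConjectureFor m Y) (a : ℕ) (y : ↥(BettiUniverse.primitiveSubHodge hHD hY DY (2 * a)).toSubmodule)
    (hy : y ∈ (BettiUniverse.primitiveHodge hHD hY DY (2 * a)).hodgeClasses a) : ofRatClass (ComplexPoints Y) (2 * a) (y : bettiCohomology Y (2 * a)) ∈ algebraicClasses Y a :=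
  hHC.2 a _ (isRationalClass_ofRatClass _)
    ((BettiUniverse.mem_hodgeClasses_hodge_iff_isOfHodgeType hHD hY a _).1 ((BettiUniverse.mem_hodgeClasses_primitiveHodge_iff hHD hY DY (2 * a) _ y).1 hy))

/-- **`HC(Y × Z)` FROM THE ODD PRIMITIVE BLOCKS AND THE EVEN BIPRIMITIVE PIECES.**  Let `Y`, `Z` be smooth projective of dimensions `m`, `n` with rational Kähler classes.  If `HC(Y)`,
`HC(Z)`, **`Hom_HS(Pⁱ(Y), Pʲ(Z)((j − i)/2)) = 0` for all odd `i ≤ m`, `j ≤ n`**, and for all `1 ≤ a`, `2a ≤ m`, `1 ≤ b`, `2b ≤ n` the biprimitive Hodge classes `t` of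
`H^{2a}(Y) ⊗ H^{2b}(Z) ⊂ H^{2(a+b)}(Y × Z)` have algebraic cross products `crossMap t ⊗ 1`, then `HC(Y × Z)`: the reduction to the biprimitive pieces `1 ≤ i ≤ m`, `1 ≤ j ≤ n` (hard Lefschetz,
Thm. 11.38/11.40, Prop. 9.20), where the odd biprimitive pieces vanish (Lemma 11.41 on the primitive parts). [cite: VoisinHodgeI2002, §6.2.3 Cor. 6.26, Rem. 6.27, §7.1.2 Lemma 7.26, §11.3.3
Thm. 11.38–11.40, Lemma 11.41, p. 287] [cite: VoisinHodgeII2003, §9.2.4 Prop. 9.20] [cite: DeligneHodgeII1971, 2.1.13–2.1.15] [cite: Deligne2000, §1] -/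
theorem BettiUniverse.hodgeConjectureFor_tensor_of_subsingleton_hom_primitiveHodge_odd (hHD : exists_isReal_hodgeModel) (hY : IsSmoothProjective m Y)
    (hZ : IsSmoothProjective n Z) (hYZ : IsSmoothProjective d (Y ⊗ Z)) (DY : KaehlerRationalDatum m Y) (DZ : KaehlerRationalDatum n Z) (hHCY : HodgeConjectureFor m Y)
    (hHCZ : HodgeConjectureFor n Z)
    (hodd : ∀ (i j c : ℕ) (hc : i + j = 2 * c), Odd i → i ≤ m → j ≤ n →
      Subsingleton (Hom (BettiUniverse.primitiveHodge hHD hY DY i) (((BettiUniverse.primitiveHodge hHD hZ DZ j).tateTwist ((c : ℤ) - i)).cast (by omega))))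
    (heven : ∀ (a b r r' : ℕ), 1 ≤ a → 2 * a ≤ m → 1 ≤ b → 2 * b ≤ n → 2 * a + r = m + 1 → 2 * b + r' = n + 1 →
      ∀ t ∈ (BettiUniverse.kunnethSummand hHD hY hZ (2 * (a + b)) ⟨(2 * a, 2 * b), HasAntidiagonal.mem_antidiagonal.2 (two_mul_add_two_mul a b)⟩).hodgeClasses (a + b : ℕ),
        TensorProduct.map (lefschetzPowTo DY.η r (2 * a) (2 * a + 2 * r) rfl) LinearMap.id t = 0 →
        TensorProduct.map LinearMap.id (lefschetzPowTo DZ.η r' (2 * b) (2 * b + 2 * r') rfl) t = 0 →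
          ofRatClass (ComplexPoints (Y ⊗ Z)) (2 * (a + b)) (BettiUniverse.crossMap Y Z (two_mul_add_two_mul a b) t) ∈ algebraicClasses (Y ⊗ Z) (a + b)) :
    HodgeConjectureFor d (Y ⊗ Z) := by
  refine BettiUniverse.hodgeConjectureFor_tensor_of_primitive_kunneth_pieces_pos hHD hY hZ hYZ DY DZ hHCY hHCZ
    fun i j c r r' hc hi1 hi hj1 hj _ hr hr' t ht h₁ h₂ ↦ ?_
  obtain ⟨a, rfl | rfl⟩ := Nat.even_or_odd' i
  · -- an even piece `H^{2a}(Y) ⊗ H^{2b}(Z)`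
    obtain ⟨b, rfl⟩ : ∃ b, j = 2 * b := ⟨c - a, by omega⟩
    obtain rfl : c = a + b := by omega
    exact heven a b r r' (by omega) hi (by omega) hj hr hr' t ht h₁ h₂
  · -- an odd piece: its biprimitive Hodge classes vanish
    have h0 : t = 0 := BettiUniverse.eq_zero_of_biprimitive_of_subsingleton_hom hHD hY hZ DY DZ hc hi hj hr hr' (hodd _ j c hc ⟨a, rfl⟩ hi hj) ht h₁ h₂
    rw [h0, map_zero, map_zero]
    exact Submodule.zero_mem _

/-- **`HC(Y × Z)` FROM THE ODD PRIMITIVE BLOCKS AND THE PRIMITIVE COUNTS.**  As above, with the even biprimitive pieces discharged by counting: if `HC(Y)`, `HC(Z)`,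
`Hom_HS(Pⁱ(Y), Pʲ(Z)((j − i)/2)) = 0` for all odd `i ≤ m`, `j ≤ n`, and **`dim_ℚ Hom_HS(P^{2a}(Y), P^{2b}(Z)(b − a)) ≤ dim_ℚ Hdgᵃ(P^{2a}(Y)) · dim_ℚ Hdgᵇ(P^{2b}(Z))`** for all `1 ≤ a`,
`2a ≤ m`, `1 ≤ b`, `2b ≤ n` (no exceptional Hodge classes on the primitive piece `P^{2a}(Y) ⊗ P^{2b}(Z)`, Lemma 11.41), then `HC(Y × Z)` — the primitive Hodge classes of `Y`, `Z` being
algebraic under `HC(Y)`, `HC(Z)`. [cite: VoisinHodgeI2002, §6.2.3 Cor. 6.26, Rem. 6.27, §7.1.2 Lemma 7.26, §11.3.3 Thm. 11.38–11.40, Lemma 11.41, p. 287] [cite: VoisinHodgeII2003, §9.2.4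
Prop. 9.20] [cite: DeligneHodgeII1971, 2.1.13–2.1.15] [cite: Deligne2000, §1] -/
theorem BettiUniverse.hodgeConjectureFor_tensor_of_subsingleton_hom_primitiveHodge_odd_of_finrank_hom_le (hHD : exists_isReal_hodgeModel) (hY : IsSmoothProjective m Y)
    (hZ : IsSmoothProjective n Z) (hYZ : IsSmoothProjective d (Y ⊗ Z)) (DY : KaehlerRationalDatum m Y) (DZ : KaehlerRationalDatum n Z) (hHCY : HodgeConjectureFor m Y)
    (hHCZ : HodgeConjectureFor n Z)
    (hodd : ∀ (i j c : ℕ) (hc : i + j = 2 * c), Odd i → i ≤ m → j ≤ n →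
      Subsingleton (Hom (BettiUniverse.primitiveHodge hHD hY DY i) (((BettiUniverse.primitiveHodge hHD hZ DZ j).tateTwist ((c : ℤ) - i)).cast (by omega))))
    (hcount : ∀ a b : ℕ, 1 ≤ a → 2 * a ≤ m → 1 ≤ b → 2 * b ≤ n →
      Module.finrank ℚ (Hom (BettiUniverse.primitiveHodge hHD hY DY (2 * a)) (((BettiUniverse.primitiveHodge hHD hZ DZ (2 * b)).tateTwist ((b : ℤ) - a)).cast (by push_cast; ring))) ≤
        Module.finrank ℚ ↥((BettiUniverse.primitiveHodge hHD hY DY (2 * a)).hodgeClasses a) * Module.finrank ℚ ↥((BettiUniverse.primitiveHodge hHD hZ DZ (2 * b)).hodgeClasses b)) :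
    HodgeConjectureFor d (Y ⊗ Z) :=
  BettiUniverse.hodgeConjectureFor_tensor_of_subsingleton_hom_primitiveHodge_odd hHD hY hZ hYZ DY DZ hHCY hHCZ hodd
    fun a b _ _ ha1 ha hb1 hb hr hr' _ ht h₁ h₂ ↦
      BettiUniverse.ofRatClass_crossMap_mem_algebraicClasses_of_biprimitive_of_finrank_hom_le hHD hY hZ DY DZ ha hb hr hr'
        (fun y hy ↦ BettiUniverse.ofRatClass_mem_algebraicClasses_of_mem_hodgeClasses_primitiveHodge_of_hodgeConjectureFor hHD hY DY hHCY a y hy)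
        (fun z hz ↦ BettiUniverse.ofRatClass_mem_algebraicClasses_of_mem_hodgeClasses_primitiveHodge_of_hodgeConjectureFor hHD hZ DZ hHCZ b z hz)
        (hcount a b ha1 ha hb1 hb) ht h₁ h₂

omit [HodgeTensorFacts.{0, 0}] in
/-- **The top odd `Hom_HS` governs all odd primitive blocks**: for `mₒ ≤ m ≤ mₒ + 1`, `nₒ ≤ n ≤ nₒ + 1` odd and `nₒ − 2s = mₒ`, `Hom_HS(H^{mₒ}(Y), H^{nₒ}(Z)(s)) = 0` ⟹
`Hom_HS(Pⁱ(Y), Pʲ(Z)((j − i)/2)) = 0` for all odd `i ≤ m`, `j ≤ n` (each is the block `((i, (mₒ − i)/2), (j, (nₒ − j)/2))`). [cite: VoisinHodgeI2002, §6.2.3 Cor. 6.26, Rem. 6.27 and §7.3.1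
Lemma 7.23, Lemma 7.26] [cite: DeligneHodgeII1971, 2.1, 2.1.13–2.1.14] -/
theorem BettiUniverse.subsingleton_hom_primitiveHodge_odd_of_subsingleton_hom_hodge_top (hHD : exists_isReal_hodgeModel) (hY : IsSmoothProjective m Y) (hZ : IsSmoothProjective n Z)
    (DY : KaehlerRationalDatum m Y) (DZ : KaehlerRationalDatum n Z) {mₒ nₒ : ℕ} (hmₒ : Odd mₒ) (hmₒm : mₒ ≤ m) (hmmₒ : m ≤ mₒ + 1) (hnₒ : Odd nₒ) (hnₒn : nₒ ≤ n)
    (hnnₒ : n ≤ nₒ + 1) {s : ℤ} (hs : (nₒ : ℤ) - 2 * s = mₒ) (h : Subsingleton (Hom (BettiUniverse.hodge hHD hY mₒ) (((BettiUniverse.hodge hHD hZ nₒ).tateTwist s).cast hs)))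
    {i j c : ℕ} (hc : i + j = 2 * c) (hio : Odd i) (hi : i ≤ m) (hj : j ≤ n) :
    Subsingleton (Hom (BettiUniverse.primitiveHodge hHD hY DY i) (((BettiUniverse.primitiveHodge hHD hZ DZ j).tateTwist ((c : ℤ) - i)).cast (by omega))) := by
  obtain ⟨a, rfl⟩ := hio
  obtain ⟨k, hk⟩ := hmₒ
  obtain ⟨l, hl⟩ := hnₒ
  exact BettiUniverse.subsingleton_hom_primitiveHodge_of_subsingleton_hom_hodge hHD hY hZ DY DZ hs h (ti := k - a) (tj := l + a + 1 - c) (by omega) (by omega) (by omega)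
    (by omega) hc

/-- **`HC(Y × Z)` FROM THE TOP ODD `Hom_HS` AND THE EVEN BIPRIMITIVE PIECES.**  Let `Y`, `Z` be smooth projective of dimensions `m`, `n` with rational Kähler classes, `mₒ ≤ m ≤ mₒ + 1`,
`nₒ ≤ n ≤ nₒ + 1` odd (the top odd degrees), `nₒ − 2s = mₒ`.  If `HC(Y)`, `HC(Z)`, **`Hom_HS(H^{mₒ}(Y), H^{nₒ}(Z)(s)) = 0`**, and for all `1 ≤ a`, `2a ≤ m`, `1 ≤ b`, `2b ≤ n` the biprimitive Hodge
classes `t` of `H^{2a}(Y) ⊗ H^{2b}(Z) ⊂ H^{2(a+b)}(Y × Z)` have algebraic cross products `crossMap t ⊗ 1`, then `HC(Y × Z)`: the odd primitive blocks are blocks of the one vanishing `Hom_HS`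
(`H^{mₒ} = ⊕ Lᵗ P^{mₒ − 2t}`, all odd `i ≤ m` occur). [cite: VoisinHodgeI2002, §6.2.3 Cor. 6.26, Rem. 6.27, §7.3.1 Lemma 7.23, Lemma 7.26, §11.3.3 Thm. 11.38–11.40, Lemma 11.41, p. 287]
[cite: VoisinHodgeII2003, §9.2.4 Prop. 9.20] [cite: DeligneHodgeII1971, 2.1.13–2.1.15] [cite: Deligne2000, §1] -/
theorem BettiUniverse.hodgeConjectureFor_tensor_of_subsingleton_hom_hodge_odd (hHD : exists_isReal_hodgeModel) (hY : IsSmoothProjective m Y) (hZ : IsSmoothProjective n Z)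
    (hYZ : IsSmoothProjective d (Y ⊗ Z)) (DY : KaehlerRationalDatum m Y) (DZ : KaehlerRationalDatum n Z) (hHCY : HodgeConjectureFor m Y) (hHCZ : HodgeConjectureFor n Z)
    {mₒ nₒ : ℕ} (hmₒ : Odd mₒ) (hmₒm : mₒ ≤ m) (hmmₒ : m ≤ mₒ + 1) (hnₒ : Odd nₒ) (hnₒn : nₒ ≤ n) (hnnₒ : n ≤ nₒ + 1) {s : ℤ} (hs : (nₒ : ℤ) - 2 * s = mₒ)
    (hodd : Subsingleton (Hom (BettiUniverse.hodge hHD hY mₒ) (((BettiUniverse.hodge hHD hZ nₒ).tateTwist s).cast hs)))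
    (heven : ∀ (a b r r' : ℕ), 1 ≤ a → 2 * a ≤ m → 1 ≤ b → 2 * b ≤ n → 2 * a + r = m + 1 → 2 * b + r' = n + 1 →
      ∀ t ∈ (BettiUniverse.kunnethSummand hHD hY hZ (2 * (a + b)) ⟨(2 * a, 2 * b), HasAntidiagonal.mem_antidiagonal.2 (two_mul_add_two_mul a b)⟩).hodgeClasses (a + b : ℕ),
        TensorProduct.map (lefschetzPowTo DY.η r (2 * a) (2 * a + 2 * r) rfl) LinearMap.id t = 0 →
        TensorProduct.map LinearMap.id (lefschetzPowTo DZ.η r' (2 * b) (2 * b + 2 * r') rfl) t = 0 →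
          ofRatClass (ComplexPoints (Y ⊗ Z)) (2 * (a + b)) (BettiUniverse.crossMap Y Z (two_mul_add_two_mul a b) t) ∈ algebraicClasses (Y ⊗ Z) (a + b)) :
    HodgeConjectureFor d (Y ⊗ Z) :=
  BettiUniverse.hodgeConjectureFor_tensor_of_subsingleton_hom_primitiveHodge_odd hHD hY hZ hYZ DY DZ hHCY hHCZ
    (fun _ _ _ hc hio hi hj ↦ BettiUniverse.subsingleton_hom_primitiveHodge_odd_of_subsingleton_hom_hodge_top hHD hY hZ DY DZ hmₒ hmₒm hmmₒ hnₒ hnₒn hnnₒ hs hodd hc hio hi hj)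
    heven

/-- **`HC(Y × Z)` FROM THE TOP ODD `Hom_HS` AND THE PRIMITIVE COUNTS.**  As above, with the even biprimitive pieces discharged by counting: if `HC(Y)`, `HC(Z)`,
`Hom_HS(H^{mₒ}(Y), H^{nₒ}(Z)(s)) = 0` (`mₒ ≤ m ≤ mₒ + 1`, `nₒ ≤ n ≤ nₒ + 1` odd, `nₒ − 2s = mₒ`) and **`dim_ℚ Hom_HS(P^{2a}(Y), P^{2b}(Z)(b − a)) ≤ dim_ℚ Hdgᵃ(P^{2a}(Y)) · dim_ℚ Hdgᵇ(P^{2b}(Z))`**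
for all `1 ≤ a`, `2a ≤ m`, `1 ≤ b`, `2b ≤ n`, then `HC(Y × Z)`. [cite: VoisinHodgeI2002, §6.2.3 Cor. 6.26, Rem. 6.27, §7.3.1 Lemma 7.23, Lemma 7.26, §11.3.3 Thm. 11.38–11.40, Lemma 11.41,
p. 287] [cite: VoisinHodgeII2003, §9.2.4 Prop. 9.20] [cite: DeligneHodgeII1971, 2.1.13–2.1.15] [cite: Deligne2000, §1] -/
theorem BettiUniverse.hodgeConjectureFor_tensor_of_subsingleton_hom_hodge_odd_of_finrank_hom_primitiveHodge_le (hHD : exists_isReal_hodgeModel)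
    (hY : IsSmoothProjective m Y) (hZ : IsSmoothProjective n Z) (hYZ : IsSmoothProjective d (Y ⊗ Z)) (DY : KaehlerRationalDatum m Y) (DZ : KaehlerRationalDatum n Z)
    (hHCY : HodgeConjectureFor m Y) (hHCZ : HodgeConjectureFor n Z) {mₒ nₒ : ℕ} (hmₒ : Odd mₒ) (hmₒm : mₒ ≤ m) (hmmₒ : m ≤ mₒ + 1) (hnₒ : Odd nₒ) (hnₒn : nₒ ≤ n)
    (hnnₒ : n ≤ nₒ + 1) {s : ℤ} (hs : (nₒ : ℤ) - 2 * s = mₒ)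
    (hodd : Subsingleton (Hom (BettiUniverse.hodge hHD hY mₒ) (((BettiUniverse.hodge hHD hZ nₒ).tateTwist s).cast hs)))
    (hcount : ∀ a b : ℕ, 1 ≤ a → 2 * a ≤ m → 1 ≤ b → 2 * b ≤ n →
      Module.finrank ℚ (Hom (BettiUniverse.primitiveHodge hHD hY DY (2 * a)) (((BettiUniverse.primitiveHodge hHD hZ DZ (2 * b)).tateTwist ((b : ℤ) - a)).cast (by push_cast; ring))) ≤
        Module.finrank ℚ ↥((BettiUniverse.primitiveHodge hHD hY DY (2 * a)).hodgeClasses a) * Module.finrank ℚ ↥((BettiUniverse.primitiveHodge hHD hZ DZ (2 * b)).hodgeClasses b)) :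
    HodgeConjectureFor d (Y ⊗ Z) :=
  BettiUniverse.hodgeConjectureFor_tensor_of_subsingleton_hom_primitiveHodge_odd_of_finrank_hom_le hHD hY hZ hYZ DY DZ hHCY hHCZ
    (fun _ _ _ hc hio hi hj ↦ BettiUniverse.subsingleton_hom_primitiveHodge_odd_of_subsingleton_hom_hodge_top hHD hY hZ DY DZ hmₒ hmₒm hmmₒ hnₒ hnₒn hnnₒ hs hodd hc hio hi hj)
    hcount

end Criterion

section Instances

variable [HodgeTensorFacts.{0, 0}]

/-- **`HC(F × F')` FOR TWO SMOOTH PROJECTIVE FOURFOLDS** satisfying `HC(F)`, `HC(F')`, **`Hom_HS(H³(F), H³(F')) = 0`** and the four primitive counts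
`dim Hom_HS(P²F, P²F') ≤ ρ₀(F)ρ₀(F')`, `dim Hom_HS(P²F, P⁴F'(1)) ≤ ρ₀(F)σ(F')`, `dim Hom_HS(P²F', P⁴F(1)) ≤ ρ₀(F')σ(F)`, `dim Hom_HS(P⁴F, P⁴F') ≤ σ(F)σ(F')` (`ρ₀ = dim Hdg¹(P²)`,
`σ = dim Hdg²(P⁴)`): the odd pieces `H¹ ⊗ H'³`, `H³ ⊗ H'¹`, `H¹ ⊗ H'¹`, `H³ ⊗ H'³` are blocks of `Hom_HS(H³F, H³F')` (`H³ = P³ ⊕ L P¹`), the even ones are counted. [cite: VoisinHodgeI2002,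
§6.2.3 Cor. 6.26, Rem. 6.27, §7.3.1 Lemma 7.23, Lemma 7.26, §11.3.3 Thm. 11.38–11.40, Lemma 11.41, p. 287] [cite: VoisinHodgeII2003, §9.2.4 Prop. 9.20] [cite: Deligne2000, §1] -/
theorem BettiUniverse.hodgeConjectureFor_tensor_fourfolds_of_subsingleton_hom_three_of_finrank_hom_primitiveHodge_le (hHD : exists_isReal_hodgeModel)
    (hF : IsSmoothProjective 4 F) (hF' : IsSmoothProjective 4 F') (hFF' : IsSmoothProjective 8 (F ⊗ F')) (D : KaehlerRationalDatum 4 F) (D' : KaehlerRationalDatum 4 F')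
    (hHC : HodgeConjectureFor 4 F) (hHC' : HodgeConjectureFor 4 F') (h33 : Subsingleton (Hom (BettiUniverse.hodge hHD hF 3) (BettiUniverse.hodge hHD hF' 3)))
    (h22 : Module.finrank ℚ (Hom (BettiUniverse.primitiveHodge hHD hF D 2) (BettiUniverse.primitiveHodge hHD hF' D' 2)) ≤
      Module.finrank ℚ ↥((BettiUniverse.primitiveHodge hHD hF D 2).hodgeClasses 1) * Module.finrank ℚ ↥((BettiUniverse.primitiveHodge hHD hF' D' 2).hodgeClasses 1))
    (h24 : Module.finrank ℚ (Hom (BettiUniverse.primitiveHodge hHD hF D 2) (((BettiUniverse.primitiveHodge hHD hF' D' 4).tateTwist 1).cast (by norm_num))) ≤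
      Module.finrank ℚ ↥((BettiUniverse.primitiveHodge hHD hF D 2).hodgeClasses 1) * Module.finrank ℚ ↥((BettiUniverse.primitiveHodge hHD hF' D' 4).hodgeClasses 2))
    (h42 : Module.finrank ℚ (Hom (BettiUniverse.primitiveHodge hHD hF' D' 2) (((BettiUniverse.primitiveHodge hHD hF D 4).tateTwist 1).cast (by norm_num))) ≤
      Module.finrank ℚ ↥((BettiUniverse.primitiveHodge hHD hF' D' 2).hodgeClasses 1) * Module.finrank ℚ ↥((BettiUniverse.primitiveHodge hHD hF D 4).hodgeClasses 2))
    (h44 : Module.finrank ℚ (Hom (BettiUniverse.primitiveHodge hHD hF D 4) (BettiUniverse.primitiveHodge hHD hF' D' 4)) ≤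
      Module.finrank ℚ ↥((BettiUniverse.primitiveHodge hHD hF D 4).hodgeClasses 2) * Module.finrank ℚ ↥((BettiUniverse.primitiveHodge hHD hF' D' 4).hodgeClasses 2)) :
    HodgeConjectureFor 8 (F ⊗ F') := by
  refine BettiUniverse.hodgeConjectureFor_tensor_of_subsingleton_hom_hodge_odd_of_finrank_hom_primitiveHodge_le hHD hF hF' hFF' D D' hHC hHC' (mₒ := 3) (nₒ := 3)
    (by decide) (by norm_num) (by norm_num) (by decide) (by norm_num) (by norm_num) (s := 0) (by norm_num) ((subsingleton_hom_twistCast_zero_right_iff _ _ _).2 h33)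
    fun a b ha1 ha hb1 hb ↦ ?_
  have ha2 : a ≤ 2 := by omega
  have hb2 : b ≤ 2 := by omega
  interval_cases a <;> interval_cases b
  · exact (finrank_hom_twistCast_right_congr (BettiUniverse.primitiveHodge hHD hF D (2 * 1)) (BettiUniverse.primitiveHodge hHD hF' D' (2 * 1))
      (show ((1 : ℕ) : ℤ) - (1 : ℕ) = 0 by norm_num) (by norm_num) (by norm_num)).trans_le ((finrank_hom_twistCast_zero_right _ _ _).trans_le h22)
  · exact (finrank_hom_twistCast_right_congr (BettiUniverse.primitiveHodge hHD hF D (2 * 1)) (BettiUniverse.primitiveHodge hHD hF' D' (2 * 2))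
      (show ((2 : ℕ) : ℤ) - (1 : ℕ) = 1 by norm_num) (by norm_num) (by norm_num)).trans_le h24
  · exact ((BettiUniverse.finrank_hom_primitiveHodge_tateTwist_swap hHD hF hF' D D' (2 * 2) (2 * 1) (s' := 1) (by norm_num) _ (by norm_num)).trans_le h42).trans_eq
      (mul_comm _ _)
  · exact (finrank_hom_twistCast_right_congr (BettiUniverse.primitiveHodge hHD hF D (2 * 2)) (BettiUniverse.primitiveHodge hHD hF' D' (2 * 2))
      (show ((2 : ℕ) : ℤ) - (2 : ℕ) = 0 by norm_num) (by norm_num) (by norm_num)).trans_le ((finrank_hom_twistCast_zero_right _ _ _).trans_le h44)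

/-- **`HC(T × F)` FOR A SMOOTH PROJECTIVE THREEFOLD `T` AND FOURFOLD `F`** with `HC(F)`, **`Hom_HS(H³(T), H³(F)) = 0`**, `dim Hom_HS(P²T, P²F) ≤ ρ₀(T)ρ₀(F)` and
`dim Hom_HS(P²T, P⁴F(1)) ≤ ρ₀(T)σ(F)` (`HC(T)` holds for threefolds: Lefschetz `(1,1)` and hard Lefschetz). [cite: VoisinHodgeI2002, §6.2.3 Cor. 6.26, Rem. 6.27, §7.3.1 Lemma 7.23, Lemma 7.26,
§11.3.3 Thm. 11.38–11.40, Lemma 11.41, p. 287 and §11.3.1 Thm. 11.30] [cite: VoisinHodgeII2003, §9.2.4 Prop. 9.20] [cite: Deligne2000, §1] -/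
theorem BettiUniverse.hodgeConjectureFor_threefold_tensor_fourfold_of_subsingleton_hom_three_of_finrank_hom_primitiveHodge_le (hHD : exists_isReal_hodgeModel)
    (hT : IsSmoothProjective 3 T) (hF : IsSmoothProjective 4 F) (hTF : IsSmoothProjective 7 (T ⊗ F)) (D : KaehlerRationalDatum 3 T) (D' : KaehlerRationalDatum 4 F)
    (hHC' : HodgeConjectureFor 4 F) (h33 : Subsingleton (Hom (BettiUniverse.hodge hHD hT 3) (BettiUniverse.hodge hHD hF 3)))
    (h22 : Module.finrank ℚ (Hom (BettiUniverse.primitiveHodge hHD hT D 2) (BettiUniverse.primitiveHodge hHD hF D' 2)) ≤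
      Module.finrank ℚ ↥((BettiUniverse.primitiveHodge hHD hT D 2).hodgeClasses 1) * Module.finrank ℚ ↥((BettiUniverse.primitiveHodge hHD hF D' 2).hodgeClasses 1))
    (h24 : Module.finrank ℚ (Hom (BettiUniverse.primitiveHodge hHD hT D 2) (((BettiUniverse.primitiveHodge hHD hF D' 4).tateTwist 1).cast (by norm_num))) ≤
      Module.finrank ℚ ↥((BettiUniverse.primitiveHodge hHD hT D 2).hodgeClasses 1) * Module.finrank ℚ ↥((BettiUniverse.primitiveHodge hHD hF D' 4).hodgeClasses 2)) :
    HodgeConjectureFor 7 (T ⊗ F) := by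
  refine BettiUniverse.hodgeConjectureFor_tensor_of_subsingleton_hom_hodge_odd_of_finrank_hom_primitiveHodge_le hHD hT hF hTF D D'
    (hodgeConjectureFor_of_dim_le_three_holds le_rfl hT) hHC' (mₒ := 3) (nₒ := 3) (by decide) (by norm_num) (by norm_num) (by decide) (by norm_num) (by norm_num) (s := 0)
    (by norm_num) ((subsingleton_hom_twistCast_zero_right_iff _ _ _).2 h33) fun a b ha1 ha hb1 hb ↦ ?_
  obtain rfl : a = 1 := by omega
  have hb2 : b ≤ 2 := by omega
  interval_cases b
  · exact (finrank_hom_twistCast_right_congr (BettiUniverse.primitiveHodge hHD hT D (2 * 1)) (BettiUniverse.primitiveHodge hHD hF D' (2 * 1))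
      (show ((1 : ℕ) : ℤ) - (1 : ℕ) = 0 by norm_num) (by norm_num) (by norm_num)).trans_le ((finrank_hom_twistCast_zero_right _ _ _).trans_le h22)
  · exact (finrank_hom_twistCast_right_congr (BettiUniverse.primitiveHodge hHD hT D (2 * 1)) (BettiUniverse.primitiveHodge hHD hF D' (2 * 2))
      (show ((2 : ℕ) : ℤ) - (1 : ℕ) = 1 by norm_num) (by norm_num) (by norm_num)).trans_le h24

/-- **`HC(S × F)` FOR A SMOOTH PROJECTIVE SURFACE `S` AND FOURFOLD `F`** with `HC(F)`, **`Hom_HS(H¹(S), H³(F)(1)) = 0`**, `dim Hom_HS(P²S, P²F) ≤ ρ₀(S)ρ₀(F)` and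
`dim Hom_HS(P²S, P⁴F(1)) ≤ ρ₀(S)σ(F)` (the odd pieces `H¹ ⊗ H³ ⊂ H⁴` and `H¹ ⊗ H¹`, the latter a block of the former's `Hom`; `HC(S)` holds). [cite: VoisinHodgeI2002, §6.2.3 Cor. 6.26, Rem. 6.27,
§7.3.1 Lemma 7.23, Lemma 7.26, §11.3.3 Thm. 11.38–11.40, Lemma 11.41, p. 287 and §11.3.1 Thm. 11.30] [cite: VoisinHodgeII2003, §9.2.4 Prop. 9.20] [cite: Deligne2000, §1] -/
theorem BettiUniverse.hodgeConjectureFor_surface_tensor_fourfold_of_subsingleton_hom_one_three_of_finrank_hom_primitiveHodge_le (hHD : exists_isReal_hodgeModel)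
    (hS : IsSmoothProjective 2 Y) (hF : IsSmoothProjective 4 F) (hSF : IsSmoothProjective 6 (Y ⊗ F)) (D : KaehlerRationalDatum 2 Y) (D' : KaehlerRationalDatum 4 F)
    (hHC' : HodgeConjectureFor 4 F) (h13 : Subsingleton (Hom (BettiUniverse.hodge hHD hS 1) (((BettiUniverse.hodge hHD hF 3).tateTwist 1).cast (by norm_num))))
    (h22 : Module.finrank ℚ (Hom (BettiUniverse.primitiveHodge hHD hS D 2) (BettiUniverse.primitiveHodge hHD hF D' 2)) ≤
      Module.finrank ℚ ↥((BettiUniverse.primitiveHodge hHD hS D 2).hodgeClasses 1) * Module.finrank ℚ ↥((BettiUniverse.primitiveHodge hHD hF D' 2).hodgeClasses 1))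
    (h24 : Module.finrank ℚ (Hom (BettiUniverse.primitiveHodge hHD hS D 2) (((BettiUniverse.primitiveHodge hHD hF D' 4).tateTwist 1).cast (by norm_num))) ≤
      Module.finrank ℚ ↥((BettiUniverse.primitiveHodge hHD hS D 2).hodgeClasses 1) * Module.finrank ℚ ↥((BettiUniverse.primitiveHodge hHD hF D' 4).hodgeClasses 2)) :
    HodgeConjectureFor 6 (Y ⊗ F) := by
  refine BettiUniverse.hodgeConjectureFor_tensor_of_subsingleton_hom_hodge_odd_of_finrank_hom_primitiveHodge_le hHD hS hF hSF D D'
    (hodgeConjectureFor_of_dim_le_three_holds (by norm_num) hS) hHC' (mₒ := 1) (nₒ := 3) (by decide) (by norm_num) (by norm_num) (by decide) (by norm_num) (by norm_num)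
    (s := 1) (by norm_num) h13 fun a b ha1 ha hb1 hb ↦ ?_
  obtain rfl : a = 1 := by omega
  have hb2 : b ≤ 2 := by omega
  interval_cases b
  · exact (finrank_hom_twistCast_right_congr (BettiUniverse.primitiveHodge hHD hS D (2 * 1)) (BettiUniverse.primitiveHodge hHD hF D' (2 * 1))
      (show ((1 : ℕ) : ℤ) - (1 : ℕ) = 0 by norm_num) (by norm_num) (by norm_num)).trans_le ((finrank_hom_twistCast_zero_right _ _ _).trans_le h22)
  · exact (finrank_hom_twistCast_right_congr (BettiUniverse.primitiveHodge hHD hS D (2 * 1)) (BettiUniverse.primitiveHodge hHD hF D' (2 * 2))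
      (show ((2 : ℕ) : ℤ) - (1 : ℕ) = 1 by norm_num) (by norm_num) (by norm_num)).trans_le h24

end Instances

end Literature.AlgebraicGeometry.HodgeTheory

end
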